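import Summits.Ventures.PercRepro.ProfilePointedCircuitClassesGeneric

/-!
# PercRepro — THE ASSEMBLY OF THE BOTTOM-LEVEL PER-CIRCUIT CLAIM AT EVERY NULLITY
(p5, gen 37; `proofs/P5-GM1.md` §46(b), §52(g), §53 — generic in `ν`)

If every circuit class of a matroid with `#E = ρ(E) + ν` satisfies the bottom-level per-circuit claim
`γ_C(ν) ≤ γ_C(n − ν − 1)`, then the per-point form `κ_ν(x) ≤ κ_{n−ν−1}(x)`, the pointed step `out_ν(x) ≤ in_{ν+1}(x)`,
Theorem A's step `(n − ν)·P_ν ≤ (ν + 1)·P_{ν+1}` and the co-rank-`(ν + 1)` top threshold `(I_{ρ−1})` all follow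
(the mirror identity `outCount_add_capCount_mirror`, the double countings `sum_outCount` / `sum_inCount`, the bridge
`thresholdSum_of_card_eq`).  The nullity-4 and nullity-5 assemblies (`ProfilePointedCircuitClassesTop`, `…FiveTop`)
are the instances `ν = 4, 5`; every future nullity only needs its classes.
-/

open scoped Matroid

namespace PercRepro.Cogirth

open Finset ThmH Skew Shadow Profile

variable {α : Type} [DecidableEq α] {N : Matroid α} [N.Finite]

section Assembly

/-- `κ_ν(x) ≤ κ_{n−ν−1}(x)` from the per-circuit claim of every class. -/
theorem capCount_le_of_forall_gammaC_le {ν : ℕ} (x : α)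
    (h : ∀ C : Finset α, gammaC N ν x C ≤ gammaC N ((gr N).card - (ν + 1)) x C) :
    capCount N ν x ≤ capCount N ((gr N).card - (ν + 1)) x := by
  rw [capCount_eq_sum_gammaC, capCount_eq_sum_gammaC]
  exact sum_le_sum (fun C _ => h C)

/-- `out_ν(x) ≤ in_{ν+1}(x)` from the per-circuit claim of every class (the mirror identity). -/
theorem outCount_le_inCount_succ_of_forall_gammaC_le {ν : ℕ} (hn : ν + 1 ≤ (gr N).card) {x : α}
    (hx : x ∈ gr N) (h : ∀ C : Finset α, gammaC N ν x C ≤ gammaC N ((gr N).card - (ν + 1)) x C) :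
    outCount N ν x ≤ inCount N (ν + 1) x := by
  have h1 := outCount_add_capCount_mirror (M := N) ν hx hn
  have h2 := capCount_le_of_forall_gammaC_le x h
  omega

/-- **THEOREM A'S STEP AT THE BOTTOM LEVEL FROM THE PER-CIRCUIT CLASSES**: if every class of every point satisfies the
bottom-level per-circuit claim, `(n − ν)·P_ν ≤ (ν + 1)·P_{ν+1}`. -/
theorem biIndep_step_of_forall_gammaC_le {ν : ℕ} (hn : ν + 1 ≤ (gr N).card)
    (h : ∀ x ∈ gr N, ∀ C : Finset α, gammaC N ν x C ≤ gammaC N ((gr N).card - (ν + 1)) x C) :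
    ((gr N).card - ν) * (biIndepSets N ν).card ≤ (ν + 1) * (biIndepSets N (ν + 1)).card := by
  rw [← sum_outCount, ← sum_inCount]
  exact sum_le_sum (fun x hx => outCount_le_inCount_succ_of_forall_gammaC_le hn hx (h x hx))

/-- **THE CO-RANK-`(ν + 1)` TOP THRESHOLD ON `#E = ρ(E) + ν` FROM THE PER-CIRCUIT CLASSES** (`1 ≤ ν`, `1 ≤ ρ(E)`): the body
of `thresholdIneq_of_card_eq_of_unimodal` with the single instance of the step. -/
theorem thresholdIneq_top_of_card_eq_of_forall_gammaC_le {ν : ℕ} (hν : 1 ≤ ν) (hR : 1 ≤ rk N (gr N))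
    (hn : (gr N).card = rk N (gr N) + ν)
    (h : ∀ x ∈ gr N, ∀ C : Finset α, gammaC N ν x C ≤ gammaC N ((gr N).card - (ν + 1)) x C) :
    ThresholdIneq N (ν + 1) (rk N (gr N) - 1) := by
  have hn' : (gr N).card = (rk N (gr N) - 1) + (ν + 1) := by omega
  unfold ThresholdIneq
  rw [thresholdSum_of_card_eq hn' (by omega), levelSetCoQ_eq_biIndepSets_of_card_eq hn']
  have hstep := biIndep_step_of_forall_gammaC_le (by omega) h
  have e1 : (gr N).card - ν = (rk N (gr N) - 1) + 1 := by omega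
  have e2 : ν + 1 - 1 = ν := by omega
  rw [e1] at hstep
  rw [e2]
  exact hstep

/-- **THE CO-RANK-`q` TOP THRESHOLD AT NULLITY `≤ q − 1` FROM THE PER-CIRCUIT CLASSES OF NULLITY `q − 1`** (`2 ≤ q`,
`ρ(E) ≥ q`): nullity `≤ q − 2` is vacuous, rank `q` the trivial row, nullity `q − 1` at rank `> q` the instance above. -/
theorem thresholdIneq_top_of_nullity_le_pred_of_forall_gammaC_le {q : ℕ} (hq : 2 ≤ q)
    (hn : (gr N).card ≤ rk N (gr N) + (q - 1)) (hR : q ≤ rk N (gr N))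
    (h : (gr N).card = rk N (gr N) + (q - 1) →
      ∀ x ∈ gr N, ∀ C : Finset α, gammaC N (q - 1) x C ≤ gammaC N ((gr N).card - q) x C) :
    ThresholdIneq N q (rk N (gr N) - 1) := by
  by_cases hlow : (gr N).card + 2 ≤ rk N (gr N) + q
  · exact thresholdIneq_top_of_card_add_two_le hq hlow
  · by_cases hRq : rk N (gr N) = q
    · exact thresholdIneq_top_of_rk_eq (by omega) hRq
    · have hn' : (gr N).card = rk N (gr N) + (q - 1) := by omega
      have h' := h hn'
      have e : q - 1 + 1 = q := by omega
      have := thresholdIneq_top_of_card_eq_of_forall_gammaC_le (ν := q - 1) (by omega) (by omega) hn'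
        (by
          intro x hx C
          have := h' x hx C
          rwa [← e] at this)
      rwa [e] at this

end Assembly

end PercRepro.Cogirth
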